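import Mathlib.Analysis.InnerProductSpace.PiL2
import Mathlib.Analysis.SpecialFunctions.Pow.Real
import Mathlib.Topology.UniformSpace.HeineCantor
import HarnessLib

/-!
# S2β · LAPLACE row — (DET-REP-A glue): CONTINUITY OF A MINIMISER FAMILY UNDER QUADRATIC GROWTH, and THE CORNER CONSTANT IN EXPONENTIAL FORM (pen w5-20520 g14)

Cell `ym3-torus` (rung R3: continuum `SU(2)` Yang–Mills on `T³` — NOT `d = 4`, NOT infinite volume, NOT a mass gap, NOT Clay); width seat `ym-ust-20520-w5` g14;
helper of the crux `stmt-QuantumFields-20520` (`--supports`, NOT a proof of it).  THEOREMS ONLY (0 `def`, 0 `sorry`; default heartbeats); generic.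

WHY (FOUR-POINT-DECAY of LINE g18-1 v10.1; LINE-OWNER RULING (W3) 21:29Z: v11 = DET-REP-A «(REP)+(DET) for the operators OF RECORD» on the common-tube route —
`M(s,t) :=` the matrix of the Hessian of `y ↦ A(c.Φ(x(s,t), σ_U y))` at the transversal coordinate `y(s,t)` of the moving minimiser, `N := 1`, `jl := log(jV·jac)`).
Two pieces of glue the DET-REP-A supplier needs and the tree lacks:
* §1 ★★ `tendsto_of_isMinOn_of_growth` — the `hy : ContinuousAt y 0` input of ✓IFT-min (`…CriticalFamily.contDiffAt_of_criticalFamily`, p745062): a family of minimisers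
  `y s` of `f s` over a compact set `K`, with `f` jointly continuous near `{s₀} × K` and QUADRATIC GROWTH of `f s₀` away from `y s₀` (GAP♯ ∘ (T2) in the tube), is
  continuous at `s₀` (uniform closeness on the compact fibre: Mathlib `IsCompact.mem_uniformity_of_prod`).
* §2 ★ `cornerConst_eq_exp` — the constant of ✓(CT-dock) `cornerLimit_shift_of_dockFactorised` ∕ ✓(CT) `laplaceLimit_of_charts_tendsto_shift`,
  `A·(B·(I·a∕M)·j∕√D)∕P`, rewritten as `exp (log(A·B·I∕(M·P)) + (log a + log j) − ½·log D)` — the (REP) shape `exp(c₀ + Σ jl + log det N − ½ log det M)` with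
  `N := 1`, `c₀ := log(A·B·I∕(M·P))` CORNER-FREE, `Σ jl := log a + log j` (`a = jV(y)`, `j = jac`), `D = det Ah`.

HONEST SCOPE.  Generic topology ∕ real algebra; proves no stub; FOUR-POINT-DECAY ∕ LAPLACE ∕ S2β ∕ the crux 20520 NOT proved; `YM3TorusSU2` NOT proved; the Yang–Mills mass gap
(Clay) NOT proved.

References: [Balaban1985Variational] CMP 102 (1985) Thm 1 (8)–(10) p. 279, (142) p. 299; [Dieudonne1960] Ch. X §2 (10.2.1); [Breitung1994] Thm 41 p. 56.
-/

noncomputable section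

open Filter Topology Set Function Metric

namespace Summit.QuantumFields.YangMills.Theorems.FluctuationComparisonRegPrIntLS2BetaArgminGlue

/-! ## §1 A minimiser family is continuous under quadratic growth -/

/-- ★★ **CONTINUITY OF A MINIMISER FAMILY UNDER QUADRATIC GROWTH.**  `f : S → E → ℝ` jointly continuous on `U ×ˢ K` (`U ∈ 𝓝 s₀`, `K` compact); for `s` near `s₀`,
`y s ∈ K` minimises `f s` over `K`; and `f s₀ e ≥ f s₀ (y s₀) + c·‖e − y s₀‖²` on `K` with `c > 0`.  Then `y → y s₀` as `s → s₀`.  (For `s` close to `s₀`,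
`|f s − f s₀| < η` uniformly on `K`, so `c‖y s − y s₀‖² ≤ f s₀ (y s) − f s₀ (y s₀) < (f s (y s) + η) − (f s (y s₀) − η) ≤ 2η`.)
[cite: Balaban1985Variational, (142) p.299 (bookkeeping: growth ⇒ stability of the minimiser)] -/
theorem tendsto_of_isMinOn_of_growth {S E : Type*} [TopologicalSpace S] [NormedAddCommGroup E]
    {f : S → E → ℝ} {y : S → E} {s₀ : S} {K : Set E} {U : Set S} {c : ℝ}
    (hK : IsCompact K) (hU : U ∈ 𝓝 s₀) (hf : ContinuousOn f.uncurry (U ×ˢ K))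
    (hyK : ∀ᶠ s in 𝓝 s₀, y s ∈ K) (hy₀K : y s₀ ∈ K)
    (hmin : ∀ᶠ s in 𝓝 s₀, ∀ e ∈ K, f s (y s) ≤ f s e)
    (hc : 0 < c) (hgrow : ∀ e ∈ K, f s₀ (y s₀) + c * ‖e - y s₀‖ ^ 2 ≤ f s₀ e) :
    Tendsto y (𝓝 s₀) (𝓝 (y s₀)) := by
  rw [Metric.tendsto_nhds]
  intro ε hε
  set η : ℝ := c * ε ^ 2 / 4 with hη
  have hη0 : 0 < η := by positivity
  obtain ⟨v, hv, hvK⟩ := hK.mem_uniformity_of_prod hf (mem_of_mem_nhds hU) (Metric.dist_mem_uniformity hη0)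
  have hv' : v ∈ 𝓝 s₀ := by rwa [nhdsWithin_eq_nhds.2 hU] at hv
  filter_upwards [hv', hyK, hmin] with s hsv hsK hsmin
  have h1 : c * ‖y s - y s₀‖ ^ 2 ≤ f s₀ (y s) - f s₀ (y s₀) := by linarith [hgrow (y s) hsK]
  have h2 : dist (f s (y s)) (f s₀ (y s)) < η := hvK s hsv (y s) hsK
  have h3 : dist (f s (y s₀)) (f s₀ (y s₀)) < η := hvK s hsv (y s₀) hy₀K
  have h4 : f s (y s) ≤ f s (y s₀) := hsmin (y s₀) hy₀K
  rw [Real.dist_eq] at h2 h3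
  have h5 : c * ‖y s - y s₀‖ ^ 2 < 2 * η := by
    have := abs_lt.1 h2; have := abs_lt.1 h3; linarith
  have h6 : ‖y s - y s₀‖ ^ 2 < ε ^ 2 := by
    have h7 : c * ‖y s - y s₀‖ ^ 2 < c * ε ^ 2 := by rw [hη] at h5; nlinarith
    exact lt_of_mul_lt_mul_left h7 hc.le
  rw [dist_eq_norm]
  exact lt_of_pow_lt_pow_left₀ 2 hε.le h6

/-! ## §2 The corner constant in exponential form -/

/-- ★ **THE CORNER CONSTANT IN (REP)'s EXPONENTIAL FORM.**  For positive `A B I a M j D P`: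
`A·(B·(I·a∕M)·j∕√D)∕P = exp (log(A·B·I∕(M·P)) + (log a + log j) − ½·log D)` — the constant of ✓`laplaceLimit_of_charts_tendsto_shift` ∕ ✓`cornerLimit_shift_of_dockFactorised`
(`A = (2π)^{dV/2}`, `B = ν(univ)`, `I = ∫_{ball ρ} jZ`, `a = jV y₁`, `M = ν((e''ball ρ)·Sst)`, `j = jac(V, σ y₁)`, `D = det Ah`, `P = β_K^{dV/2}`) as
`exp(c₀ + Σ jl + log det 1 − ½ log det M)` with the corner-free `c₀ := log(A·B·I∕(M·P))`. [cite: Breitung1994, Thm 41 p.56 (the constant)] -/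
theorem cornerConst_eq_exp {A B I a M j D P : ℝ} (hA : 0 < A) (hB : 0 < B) (hI : 0 < I) (ha : 0 < a) (hM : 0 < M) (hj : 0 < j)
    (hD : 0 < D) (hP : 0 < P) :
    A * (B * (I * a / M) * j / Real.sqrt D) / P =
      Real.exp (Real.log (A * B * I / (M * P)) + (Real.log a + Real.log j) - (1 / 2) * Real.log D) := by
  have hABI : 0 < A * B * I / (M * P) := by positivity
  have hsq : Real.sqrt D = Real.exp ((1 / 2) * Real.log D) := by
    rw [Real.sqrt_eq_rpow, Real.rpow_def_of_pos hD, mul_comm]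
  rw [Real.exp_sub, Real.exp_add, Real.exp_add, Real.exp_log hABI, Real.exp_log ha, Real.exp_log hj, ← hsq]
  have hsqD : 0 < Real.sqrt D := Real.sqrt_pos.2 hD
  field_simp

/-- **… AND ITS LOGARITHM**: `log (A·(B·(I·a∕M)·j∕√D)∕P) = log(A·B·I∕(M·P)) + (log a + log j) − ½·log D`. [cite: Breitung1994, Thm 41 p.56 (the constant)] -/
theorem log_cornerConst {A B I a M j D P : ℝ} (hA : 0 < A) (hB : 0 < B) (hI : 0 < I) (ha : 0 < a) (hM : 0 < M) (hj : 0 < j)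
    (hD : 0 < D) (hP : 0 < P) :
    Real.log (A * (B * (I * a / M) * j / Real.sqrt D) / P) =
      Real.log (A * B * I / (M * P)) + (Real.log a + Real.log j) - (1 / 2) * Real.log D := by
  rw [cornerConst_eq_exp hA hB hI ha hM hj hD hP, Real.log_exp]

end Summit.QuantumFields.YangMills.Theorems.FluctuationComparisonRegPrIntLS2BetaArgminGlue

end
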